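import Literature.Probability.Percolation.FourArmGarbanTwoArms
import Literature.Probability.LatticeModels.FKExplorationDomainMarkov
import Literature.Probability.LatticeModels.MedialExplorationChains
import HarnessLib

/-!
# Garban's revealment `Y_j` for the medial exploration: two arms from every explored edge

Topic `Literature/Probability/Percolation`; support file for the named fact
`Garban2011_fourArm_multiscale` (`FourArmGarban.lean`; C. Garban, Appendix B of O. Schramm,
S. Smirnov, Ann. Probab. 39 (2011), Lemma B.1). Bond percolation on `ℤ²`; the interface is the
tree's medial exploration path of a discrete Dobrushin domain (`MedialInterface.lean`,
`MedialInterfaceProofs.lean`: the orbit `cornerOrbit` of the turning rule from the start corner,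
cut at the exit time; Smirnov 2001, §2).

Garban (proof of Lemma B.1): "Let `γ` be the interface running between the two ends of the side
`∂₀Q` and separating the open cluster rooted on it from the dual closed cluster rooted on the
three other sides. Denote by `Y_j` the event that `γ` intersects `Q_j`. Note that, by the RSW
theory, (B.6) `P[Y_j] ≲ (r/R)^{2ε}`." The content of (B.6) is that an explored edge carries an
open arm (the primal vertices on the left of the interface chain back to the wired arc through
open edges) and a closed dual arm (the faces on its right chain back to the free arc through
dual edges crossing closed edges) — Smirnov 2001, §2, "open edges on the left, dual-open edges on
the right"; van den Berg–Nolin 2020, §5.2. This file proves it for the tree's exploration: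

* `Reveals hD E` — **the revealment event**: the exploration of `ω` arrives at an edge of the
  set `E` (strictly) before its exit time (`exploredEdge`, `exitTime` of
  `FKExplorationDomainMarkov.lean`/`FermionicObservableSums.lean`); Garban's `{Y_j = 1}` is
  `Reveals hD E_j` for `E_j` the edges of `Q_j`;
* `exists_open_walk_to_zdArcA` — the left vertex of the `n`-th corner of the orbit is joined to
  the discrete arc `A` by a walk of `ω`-OPEN edges (the wired `A`–`A` edges are only needed at
  the far end, where we stop);
* `exists_dualWalk_to_zdArcB` — for `n ≤ exitTime`, the face of the `n`-th corner is joined to a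
  face with a corner on the discrete arc `B` by a walk of dual edges of `dualConfig ω` (dual
  edges crossing `ω`-CLOSED edges; the edges closed by the boundary condition only occur at the
  far end, where we stop);
* `reveals_subset_openDualArmsAt` — hence, if the edges of `E` lie within `c + B(k)`,
  `k + 2 ≤ a`, while the arcs stay outside `c + B(b+1)`, **`Reveals hD E ⊆ openDualArmsAt c a b`**
  (`FourArmGarbanTwoArms.lean`), and `real_reveals_le_twoArmOpenDual`:
  **`P_p(Reveals hD E) ≤ π₂(a, b) = P_p(twoArmOpenDual a b)`** — the field `reveal` of
  `GarbanScheme` (`FourArmGarbanAssembly.lean`) for `V_j = Reveals hD E_j`.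

## References

* O. Schramm, S. Smirnov (appendix by C. Garban), Ann. Probab. 39 (2011), Appendix B, proof of
  Lemma B.1, (B.6) [SchrammSmirnov2011].
* S. Smirnov, *Critical percolation in the plane*, C. R. Acad. Sci. Paris 333 (2001), §2 (the
  exploration process: open on the left, dual-open on the right) [Smirnov2001].
* J. van den Berg, P. Nolin, Progr. Probab. 77 (2020), §5.2 [VandenbergNolin2020].

Tree: `cornerOrbit`, `nextCorner_of_mem`, `nextCorner_of_not_mem`, `cFace_nextCorner_of_mem`,
`cFace_nextCorner_of_not_mem`, `cSrc_nextCorner`, `cTgt`, `cFace`, `faceAt`, `cornerOff`,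
`isCorner_cFace`, `cornerTarget_cFace`, `cornerSource_cFace`, `isCorner_add_faceAt_iff`,
`exists_faceAt_of_isCorner`, `faceAt_injective`, `cTgt_mem_edgeSet`
(`MedialInterfaceProofs.lean`), `mem_dualEdge_cornerTarget`, `mem_dualEdge_cornerSource`
(`MedialExplorationChains.lean`), `DiscreteDobrushin.startCorner`, `isStartCorner_startCorner`,
`exitTime`, `isInnerFace_of_lt_exitTime` (`FermionicObservableSums.lean`), `exploredEdge`,
`cTgt_mem_edgeSet_of_isInnerFace` (`FKExplorationDomainMarkov.lean`), `bcBondConfig`,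
`mem_bcBondConfig_iff`, `discreteDomainGraph_le_meshGraph`, `meshGraph_le_zdGraph`,
`dualEdge_bijective`, `dualEdge_mem_edgeSet_holds`, `openDualArmsAt`,
`real_le_twoArmOpenDual_of_subset_openDualArmsAt` (`FourArmGarbanTwoArms.lean`).
-/

noncomputable section

namespace Literature.Probability.Percolation

open _root_.MeasureTheory Set LatticeModels LatticeModels.DiscreteDobrushin

variable {D : DiscreteDobrushin}

/-! ### The revealment event -/

/-- **The revealment event of a set of edges `E`** ("the interface `γ` intersects `Q_j`",
Garban's `{Y_j = 1}` for `E` the edges of `Q_j`): the medial exploration of the completed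
configuration arrives at an edge of `E` — the target edge of some corner of its orbit — strictly
before its exit time. (Schramm–Smirnov 2011, App. B, proof of Lemma B.1, definition of `Y_j`.)
[cite: SchrammSmirnov2011, Appendix B, proof of Lemma B.1 (definition of Y_j)] -/
def Reveals (hD : D.IsZdAdmissible) (E : Set (Sym2 (Site 2))) : Set (BondConfig (Site 2)) :=
  {ω | ∃ i < exitTime hD ω, exploredEdge hD ω i ∈ E}

/-- Membership in the revealment event, unfolded. [folklore] -/
theorem mem_reveals_iff {hD : D.IsZdAdmissible} {E : Set (Sym2 (Site 2))}
    {ω : BondConfig (Site 2)} :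
    ω ∈ Reveals hD E ↔ ∃ i < exitTime hD ω, exploredEdge hD ω i ∈ E :=
  Iff.rfl

/-- The revealment event is monotone in the edge set. [folklore] -/
theorem reveals_mono (hD : D.IsZdAdmissible) {E E' : Set (Sym2 (Site 2))} (h : E ⊆ E') :
    Reveals hD E ⊆ Reveals hD E' :=
  fun _ ⟨i, hi, he⟩ => ⟨i, hi, h he⟩

/-! ### Lattice bookkeeping -/

/-- An edge of the discrete domain is an edge of `ℤ²`. [folklore] -/
theorem adj_zdGraph_of_mem_bcBondConfig {ω : BondConfig (Site 2)} {x y : Site 2}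
    (h : s(x, y) ∈ D.bcBondConfig ω) : (zdGraph 2).Adj x y :=
  meshGraph_le_zdGraph _ _ (discreteDomainGraph_le_meshGraph _ _ (D.bcBondConfig_subset ω h))

/-- An edge that is open in the completed configuration and has an endpoint off the discrete arc
`A` is open in `ω` (the only edges opened by the boundary condition are the `A`–`A` edges).
[cite: Smirnov2001, §2] -/
theorem mem_of_mem_bcBondConfig_of_not_mem_zdArcA {ω : BondConfig (Site 2)} {e : Sym2 (Site 2)}
    {x : Site 2} (he : e ∈ D.bcBondConfig ω) (hx : x ∈ e) (hxA : x ∉ D.zdArcA) : e ∈ ω := by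
  rw [mem_bcBondConfig_iff] at he
  rcases he.2 with hA | ⟨hω, -⟩
  · exact absurd (hA x hx) hxA
  · exact hω

/-- An edge of the discrete domain that is closed in the completed configuration and touches no
site of the discrete arc `B` is closed in `ω`. [cite: Smirnov2001, §2] -/
theorem not_mem_of_not_mem_bcBondConfig {ω : BondConfig (Site 2)} {e : Sym2 (Site 2)}
    (heΩ : e ∈ (discreteDomainGraph D.Ω D.δ).edgeSet) (he : e ∉ D.bcBondConfig ω)
    (hB : ∀ x ∈ e, x ∉ D.zdArcB) : e ∉ ω := fun hω =>
  he ⟨heΩ, Or.inr ⟨hω, hB⟩⟩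

/-- For a lattice edge `e` and any configuration, the dual edge of `e` is dual-open iff `e` is
closed (`dualEdge` is a bijection of `Sym2 (Site 2)`). (Grimmett 1999, §11.2.) [folklore] -/
theorem dualEdge_mem_dualConfig_iff_not_mem {ω : BondConfig (Site 2)} {e : Sym2 (Site 2)}
    (he : e ∈ (zdGraph 2).edgeSet) : dualEdge e ∈ dualConfig ω ↔ e ∉ ω := by
  rw [mem_dualConfig_iff]
  constructor
  · rintro ⟨-, h⟩ hω
    exact h e hω rfl
  · intro h
    refine ⟨dualEdge_mem_edgeSet_holds he, fun e' he' heq => h ?_⟩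
    rwa [← dualEdge_bijective.1 heq]

/-- The second endpoint of the source edge of a coded corner is a corner of its face. [folklore] -/
theorem isCorner_add_cornerUnit_cFace (p : Site 2 × Fin 4) :
    IsCorner (p.1 + cornerUnit p.2) (cFace p) :=
  (isCorner_add_faceAt_iff p.1 p.2 p.2).2 (Or.inl rfl)

/-- Both endpoints of the source edge of a coded corner are corners of its face. [folklore] -/
theorem isCorner_cFace_of_mem_cSrc {p : Site 2 × Fin 4} {x : Site 2} (hx : x ∈ cSrc p) :
    IsCorner x (cFace p) := by
  rcases Sym2.mem_iff.1 hx with rfl | rfl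
  · exact isCorner_cFace p
  · exact isCorner_add_cornerUnit_cFace p

/-- The dual edge of the target edge of a corner joins its face to the next face
counter-clockwise around its vertex. [folklore] -/
theorem dualEdge_cTgt (p : Site 2 × Fin 4) :
    dualEdge (cTgt p) = s(cFace p, faceAt p.1 (p.2 + 1)) := by
  have h₁ : cFace p ∈ dualEdge (cTgt p) := by
    rw [← cornerTarget_cFace]
    exact mem_dualEdge_cornerTarget (isCorner_cFace p)
  have h₂ : faceAt p.1 (p.2 + 1) ∈ dualEdge (cTgt p) := by
    have : cTgt p = cSrc (p.1, p.2 + 1) := rfl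
    rw [this, ← cornerSource_cFace]
    exact mem_dualEdge_cornerSource (isCorner_cFace (p.1, p.2 + 1))
  have hne : cFace p ≠ faceAt p.1 (p.2 + 1) := fun h =>
    absurd (faceAt_injective p.1 h) (by
      have : p.2 + 1 ≠ p.2 := by
        intro h'; have := congrArg (· - p.2) h'; simp at this
      exact fun h'' => this h''.symm)
  exact (Sym2.mem_and_mem_iff hne).1 ⟨h₁, h₂⟩

/-- Faces indexed by lower-left corners: a face with a corner `x` lies within one lattice unit
of `x` (coordinatewise, `0 ≤ x - f ≤ 1`). [folklore] -/
theorem sub_mem_box_of_isCorner {x f c : Site 2} {k : ℕ} (h : IsCorner x f) (hf : f - c ∈ box 2 k) :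
    x - c ∈ box 2 (k + 1) := by
  rw [mem_box] at hf ⊢
  intro i
  have h1 := hf i
  have h2 := h i
  simp only [Pi.sub_apply] at h1 ⊢
  push_cast
  rcases h2 with h2 | h2 <;> omega

/-- Conversely: if a corner `x` of the face `f` satisfies `x - c ∈ B(k)`, then `f - c ∈ B(k+1)`.
[folklore] -/
theorem face_sub_mem_box_of_isCorner {x f c : Site 2} {k : ℕ} (h : IsCorner x f)
    (hx : x - c ∈ box 2 k) : f - c ∈ box 2 (k + 1) := by
  rw [mem_box] at hx ⊢
  intro i
  have h1 := hx i
  have h2 := h i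
  simp only [Pi.sub_apply] at h1 ⊢
  push_cast
  rcases h2 with h2 | h2 <;> omega

/-! ### The open arm on the left -/

/-- One step of the left chain: if the left vertex of the corner `q` is joined to the arc `A` by
an `ω`-open walk, so is the left vertex of its successor. [cite: Smirnov2001, §2] -/
theorem exists_open_walk_nextCorner {ω : BondConfig (Site 2)} {q : Site 2 × Fin 4} {w : Site 2}
    (p : (zdGraph 2).Walk q.1 w) (hw : w ∈ D.zdArcA) (hp : ∀ e ∈ p.edges, e ∈ ω) :
    ∃ (w' : Site 2) (p' : (zdGraph 2).Walk (nextCorner (D.bcBondConfig ω) q).1 w'),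
      w' ∈ D.zdArcA ∧ ∀ e ∈ p'.edges, e ∈ ω := by
  by_cases h : cTgt q ∈ D.bcBondConfig ω
  · rw [nextCorner_of_mem h]
    by_cases hA : q.1 + cornerUnit (q.2 + 1) ∈ D.zdArcA
    · exact ⟨_, SimpleGraph.Walk.nil, hA, by simp⟩
    · have hadj : (zdGraph 2).Adj (q.1 + cornerUnit (q.2 + 1)) q.1 :=
        (adj_zdGraph_of_mem_bcBondConfig h).symm
      have hω : cTgt q ∈ ω :=
        mem_of_mem_bcBondConfig_of_not_mem_zdArcA h (Sym2.mem_mk_right _ _) hA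
      refine ⟨w, SimpleGraph.Walk.cons hadj p, hw, fun e he => ?_⟩
      rw [SimpleGraph.Walk.edges_cons, List.mem_cons] at he
      rcases he with rfl | he
      · rw [Sym2.eq_swap]; exact hω
      · exact hp e he
  · rw [nextCorner_of_not_mem h]
    exact ⟨w, p, hw, hp⟩

/-- **Open edges on the left** (Smirnov 2001, §2): the left vertex of every corner of the orbit
of the turning rule from the start corner is joined to a site of the discrete arc `A` by a walk of
`ℤ²` all of whose edges are open in `ω` itself (following an edge makes the new left vertex an
endpoint of an open edge; we stop as soon as the walk reaches the arc `A`, so the wired `A`–`A`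
edges are never used). [cite: Smirnov2001, §2] -/
theorem exists_open_walk_to_zdArcA (hD : D.IsZdAdmissible) (ω : BondConfig (Site 2)) (n : ℕ) :
    ∃ (w : Site 2) (p : (zdGraph 2).Walk
        (cornerOrbit (D.bcBondConfig ω) (startCorner hD) n).1 w),
      w ∈ D.zdArcA ∧ ∀ e ∈ p.edges, e ∈ ω := by
  induction n with
  | zero => exact ⟨_, SimpleGraph.Walk.nil, (isStartCorner_startCorner hD).mem_zdArcA, by simp⟩
  | succ n ih =>
    obtain ⟨w, p, hw, hp⟩ := ih
    exact exists_open_walk_nextCorner p hw hp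

/-! ### The closed dual arm on the right -/

/-- One step of the right chain: if the face of the corner `q` (whose target edge is an edge of
the discrete domain) is joined to a face cornered at the arc `B` by a walk of edges of
`dualConfig ω`, so is the face of its successor. [cite: Smirnov2001, §2] -/
theorem exists_dualWalk_nextCorner {ω : BondConfig (Site 2)} {q : Site 2 × Fin 4} {w : Site 2}
    (hqΩ : cTgt q ∈ (discreteDomainGraph D.Ω D.δ).edgeSet)
    (p : (zdGraph 2).Walk (cFace q) w) (hw : ∃ x ∈ D.zdArcB, IsCorner x w)
    (hp : ∀ d ∈ p.edges, d ∈ dualConfig ω) :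
    ∃ (w' : Site 2) (p' : (zdGraph 2).Walk (cFace (nextCorner (D.bcBondConfig ω) q)) w'),
      (∃ x ∈ D.zdArcB, IsCorner x w') ∧ ∀ d ∈ p'.edges, d ∈ dualConfig ω := by
  by_cases h : cTgt q ∈ D.bcBondConfig ω
  · rw [cFace_nextCorner_of_mem h]
    exact ⟨w, p, hw, hp⟩
  · rw [cFace_nextCorner_of_not_mem h]
    by_cases hB : ∃ x ∈ cTgt q, x ∈ D.zdArcB
    · -- stop: the new face has a corner on the arc `B`
      obtain ⟨x, hx, hxB⟩ := hB
      refine ⟨_, SimpleGraph.Walk.nil, ⟨x, hxB, ?_⟩, by simp⟩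
      have : cTgt q = cSrc (q.1, q.2 + 1) := rfl
      rw [this] at hx
      exact isCorner_cFace_of_mem_cSrc hx
    · simp only [not_exists, not_and] at hB
      have hω : cTgt q ∉ ω := not_mem_of_not_mem_bcBondConfig hqΩ h hB
      have hdual : dualEdge (cTgt q) ∈ dualConfig ω :=
        (dualEdge_mem_dualConfig_iff_not_mem (cTgt_mem_edgeSet q)).2 hω
      rw [dualEdge_cTgt] at hdual
      have hadj : (zdGraph 2).Adj (faceAt q.1 (q.2 + 1)) (cFace q) := by
        have := (mem_dualConfig_iff.1 hdual).1
        exact ((SimpleGraph.mem_edgeSet (zdGraph 2)).1 this).symm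
      refine ⟨w, SimpleGraph.Walk.cons hadj p, hw, fun d hd => ?_⟩
      rw [SimpleGraph.Walk.edges_cons, List.mem_cons] at hd
      rcases hd with rfl | hd
      · rw [Sym2.eq_swap]; exact hdual
      · exact hp d hd

/-- **Dual-open edges on the right** (Smirnov 2001, §2): up to the exit time, the face of every
corner of the orbit is joined to a face having a corner on the discrete arc `B` by a walk of dual
vertices all of whose (dual) edges lie in `dualConfig ω`, i.e. cross edges closed in `ω` itself
(crossing a closed edge makes the new face a neighbour across a closed edge; an edge closed only
by the boundary condition touches the arc `B`, and there we stop). [cite: Smirnov2001, §2] -/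
theorem exists_dualWalk_to_zdArcB (hD : D.IsZdAdmissible) (ω : BondConfig (Site 2)) {n : ℕ}
    (hn : n ≤ exitTime hD ω) :
    ∃ (w : Site 2) (q : (zdGraph 2).Walk
        (cFace (cornerOrbit (D.bcBondConfig ω) (startCorner hD) n)) w),
      (∃ x ∈ D.zdArcB, IsCorner x w) ∧ ∀ d ∈ q.edges, d ∈ dualConfig ω := by
  induction n with
  | zero =>
    exact ⟨_, SimpleGraph.Walk.nil, ⟨_, (isStartCorner_startCorner hD).mem_zdArcB,
      isCorner_add_cornerUnit_cFace _⟩, by simp⟩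
  | succ n ih =>
    obtain ⟨w, p, hw, hp⟩ := ih (Nat.le_of_succ_le hn)
    have hlt : n < exitTime hD ω := hn
    exact exists_dualWalk_nextCorner
      (cTgt_mem_edgeSet_of_isInnerFace (isInnerFace_of_lt_exitTime hD ω hlt)) p hw hp

/-! ### Revealment gives two arms -/

/-- **An explored edge near `c` gives the two arms around `c`.** Let `E` be a set of pairs of
sites within `c + B(k)`, `k + 2 ≤ a`, and assume that the discrete arcs `A` and `B` stay
outside `c + B(b+1)`. If the exploration of `ω` arrives at an edge of `E` before its exit time, then
`ω ∈ openDualArmsAt c a b`: the left vertex of that corner starts the open arm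
(`exists_open_walk_to_zdArcA`) and its face starts the closed dual arm
(`exists_dualWalk_to_zdArcB`). (Schramm–Smirnov 2011, App. B, (B.6); Smirnov 2001, §2.)
[cite: SchrammSmirnov2011, Appendix B, proof of Lemma B.1, (B.6)] -/
theorem reveals_subset_openDualArmsAt (hD : D.IsZdAdmissible) {E : Set (Sym2 (Site 2))}
    {c : Site 2} {k a b : ℕ} (hka : k + 2 ≤ a) (hE : ∀ e ∈ E, ∀ x ∈ e, x - c ∈ box 2 k)
    (hA : ∀ x ∈ D.zdArcA, x - c ∉ box 2 (b + 1)) (hB : ∀ x ∈ D.zdArcB, x - c ∉ box 2 (b + 1)) :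
    Reveals hD E ⊆ openDualArmsAt c a b := by
  rintro ω ⟨i, hi, hiE⟩
  set q := cornerOrbit (D.bcBondConfig ω) (startCorner hD) i with hq
  have hv : q.1 - c ∈ box 2 k := hE _ hiE q.1 (Sym2.mem_mk_left _ _)
  constructor
  · -- the open arm
    obtain ⟨w, p, hw, hp⟩ := exists_open_walk_to_zdArcA hD ω i
    refine ⟨q.1, w, p, box_mono 2 (by omega) hv, fun h => hA w hw (box_mono 2 (by omega) h), hp⟩
  · -- the closed dual arm
    obtain ⟨w, p, ⟨x, hxB, hxw⟩, hp⟩ := exists_dualWalk_to_zdArcB hD ω hi.le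
    refine ⟨cFace q, w, p, ?_, fun h => hB x hxB (sub_mem_box_of_isCorner hxw h), hp⟩
    have := face_sub_mem_box_of_isCorner (isCorner_cFace q) hv
    exact box_mono 2 (by omega) this

/-- **(B.6) in the form of `GarbanScheme.reveal`**: under the same geometric hypotheses and
`a ≤ b`, `P_p(Reveals hD E) ≤ P_p(twoArmOpenDual a b)` for every `p` (translation
invariance; the decay of the right-hand side is the hypothesis of Garban's lemma).
[cite: SchrammSmirnov2011, Appendix B, proof of Lemma B.1, (B.6)] -/
theorem real_reveals_le_twoArmOpenDual (hD : D.IsZdAdmissible) (p : unitInterval)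
    {E : Set (Sym2 (Site 2))} {c : Site 2} {k a b : ℕ} (hka : k + 2 ≤ a) (hab : a ≤ b)
    (hE : ∀ e ∈ E, ∀ x ∈ e, x - c ∈ box 2 k)
    (hA : ∀ x ∈ D.zdArcA, x - c ∉ box 2 (b + 1)) (hB : ∀ x ∈ D.zdArcB, x - c ∉ box 2 (b + 1)) :
    (bondPercolation (zdGraph 2) p).real (Reveals hD E) ≤
      (bondPercolation (zdGraph 2) p).real (twoArmOpenDual a b) :=
  real_le_twoArmOpenDual_of_subset_openDualArmsAt p (by omega) hab
    (reveals_subset_openDualArmsAt hD hka hE hA hB)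

end Literature.Probability.Percolation
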